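import Mathlib.Algebra.MvPolynomial.Funext
import Literature.NumberTheory.Automorphic.RootSpaceDimension
import HarnessLib

/-!
# The Lie algebra of `U(y)`, `dim U(y) ≤ |R⁺(y)|`, and `U(y) = ∏ U_α` (Springer 8.2.1) by a dimension count
(characteristic `0`; trunk T-AUTOMORPHIC, G25 AutomorphicL; DAG of
`Literature.NumberTheory.Automorphic.chevalley_isomorphism`)

This file has two parts. **Part I**: the Lie algebra of
`U(y)` lies in the positive root spaces, whence `dim U(y) ≤ |R⁺(y)|` when root spaces are lines —
see the second module docstring below. **Part II**: Springer 8.2.1 by a dimension count.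

Companion to `RootProductRetraction.lean` (the named fact `posRootGroup_eq_prod` — the surjectivity
half of Springer, *Linear Algebraic Groups* (2nd ed.), 8.2.1 — and the proved injectivity half
`exists_polyRetraction_prod_rootHom`, plus `prodPolyMat`, `chevalley_isomorphism_of_eq_prod`),
Part I (`zdim_posRootGroup_le`) and `RootSpaceDimension.lean`
(`finrank_lieWeightSpace_le_one_of_rootSubgroup_unique`, `zdim_eq_rank_add_card_roots_of_rootSubgroup_unique`,
the named fact `lieWeightSpace_one_le_lieAlgebraGL`). Namespace `Literature.NumberTheory.Automorphic`.
Everything is proved: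

* `rootProd u l x = ∏_{i ∈ l} u_i(x_i)` (definition) with its polynomial coordinates
  `rootProdPoly` (`eval_rootProdPoly`) and comorphism `rootProdHom = Φ_l : k[x, y] → k[X_ι]`
  (`eval_rootProdHom`); `ker_rootProdHom_eq`: `ker Φ_l = 𝓘(Z)` for the image `Z = φ_l(k^ι)`;
  `range_rootProdHom_eq`: with a polynomial left inverse `q`, `range Φ_l = k[X_i : i ∈ l]`;
  `ringKrullDim_quotient_idealSetGL_range_rootProd`: **`k[Z] ≅ k[X_i : i ∈ l]`, so `𝓘(Z)` is prime
  and `dim k[Z] = |l|`**; `range_rootProd_eq_zeroLocusGL`: `Z = {g | φ_l(q(g)) = g}` is closed.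
* `ringKrullDim_quotient_lt_zdim_of_isPrime` — the variant of Springer 1.8.2 in `BigCellOpen.lean`
  with primality of `𝓘(Z)` as hypothesis.
* **`posRootGroup_subset_range_rootProd`** — if `dim 𝔤_{α_i} ≤ 1` for all `i`, every element of
  `U(y)` is an ordered product `∏_{i ∈ l} u_i(x_i)` (8.2.1, surjectivity): otherwise
  `dim k[Z] < dim U(y) ≤ |l| = dim k[Z]` (`zdim_posRootGroup_le`).
* **`posRootGroup_eq_prod_of_rootSubgroup_unique`** — the named fact `posRootGroup_eq_prod` from
  `rootSubgroup_unique` (8.1.1 (i)) in characteristic `0` — bypassing the commutator relations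
  8.2.3 through which `PosRootGroupProduct.lean` obtains it (and Springer's 8.2.2).
* **`chevalley_isomorphism_of_structureFacts₄`** — `chevalley_isomorphism` from
  `chevalley_isomorphism_abstract` (9.6.2, step 1), `rootSubgroup_unique` (8.1.1 (i)) and
  `lieWeightSpace_one_le_lieAlgebraGL` (5.4.7 + 7.6.4 (ii)), each for `(G, T)` and `(G', T')`.

## References

* [SpringerLAG1998] T. A. Springer, *Linear Algebraic Groups*, 2nd ed., Progress in
  Mathematics 9, Birkhäuser (1998): 1.8.2, 8.1.1 (i), Cor. 8.1.2, Cor. 8.1.3 (ii), Prop. 8.2.1,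
  8.3.11, Thm. 9.6.2 (proof).
-/

/-!
## Part I. The Lie algebra of `U(y)` lies in the positive root spaces; `dim U(y) ≤ |R⁺(y)|`
(characteristic `0`; trunk T-AUTOMORPHIC, G25 AutomorphicL; DAG of
`Literature.NumberTheory.Automorphic.chevalley_isomorphism`)

Companion to `BigCellReduction.lean` (the groups `U(y) = posRootGroup G P u y = ⟨u_i(𝔾ₐ) :
⟨α_i, y⟩ > 0⟩`, the weights `cocharWeight` of the cocharacter `λ_y` in a frame `A` diagonalising
`T`, `IsRootHom.isBlockUpperUnipotent_conj`), `BigCellOpen.lean` (`isZConnected_posRootGroup`,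
`conj_mem_posRootGroup`, `finrank_biSup_eq_sum_of_iSupIndep'`), `LieAlgebraWeights.lean`
(`adWeightSpace`, `iSup_inf_adWeightSpace_eq`, `iSupIndep_adWeightSpace`) and
`LieAlgebraGLNilpotentExp.lean` (`lieWeights_subset_roots`: `P ⊆ R` in characteristic `0`).
Namespace `Literature.NumberTheory.Automorphic`. Everything is proved:

* `lieAlgebraGL_posRootGroup_le` — **`Lie(U(y)) ⊆ ⨁_{⟨α_i, y⟩ > 0} 𝔤_{α_i}`** for `G` algebraic
  over an algebraically closed field of characteristic `0`, `T ≤ G` a torus with root datum `P`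
  and root homomorphisms `u_i` (Springer 8.2.1–8.2.2, `L(B_u) = ⨁_{α>0} 𝔤_α`; 8.1.3 (i)):
  `Lie(U(y))` is `Ad(T)`-stable, hence a sum of weight components; in the frame `A`, `U(y)` is
  block upper unipotent for the weights `m` of `λ_y`, so (`conj_apply_eq_zero_of_mem_lieAlgebraGL_posRootGroup`,
  differentiating the identities `(A g A⁻¹)_{pq} = δ_{pq}`) a non-zero entry `(p, q)` of `A B A⁻¹`,
  `B ∈ Lie(U(y))`, has `m_p > m_q`; for a weight vector `B` of weight `χ` the torus relation
  gives `χ = χ_p χ_q⁻¹` in terms of the coordinate characters, so `⟨χ, y⟩ = m_p - m_q > 0`, `χ`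
  is a non-zero weight of `T` in `Lie(G)`, hence (characteristic `0`) a root `α_i` with
  `⟨α_i, y⟩ > 0`.
* `zdim_posRootGroup_le` — hence **`dim U(y) ≤ |{i | ⟨α_i, y⟩ > 0}|`** as soon as every root space
  `𝔤_{α_i}` has dimension `≤ 1` (4.4.6: `dim U(y) = dim Lie(U(y))`, `U(y)` being connected
  algebraic; the positive root spaces are independent).
* helpers: `IsRootDatumOf.charPairingInt_charOfWeight_cocharOfCoweight`,
  `isBlockUpperUnipotent_conj_of_mem_posRootGroup`.

Used in Part II below to prove Springer 8.2.1 (surjectivity of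
`(x_i) ↦ ∏ u_i(x_i)` onto `U(y)`) by a dimension count.

## References

* [SpringerLAG1998] T. A. Springer, *Linear Algebraic Groups*, 2nd ed., Progress in
  Mathematics 9, Birkhäuser (1998): 3.2.11 (i), 4.4.6, 7.1.1, 8.1.3 (i), 8.2.1, 8.2.2, 8.2.4 (proof).
-/

noncomputable section

open scoped MatrixGroups IsMulCommutative
open Polynomial

namespace Literature.NumberTheory.Automorphic

variable {k : Type*} [Field k] {n : Type*} [Fintype n] [DecidableEq n]

/-! ### The Lie algebra of `U(y)` -/

section LiePosRootGroup

variable {ι X Y : Type*} [AddCommGroup X] [AddCommGroup Y]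
variable {G T : Subgroup (GL n k)} [IsMulCommutative ↥T]
variable {P : RootPairing ι ℤ X Y} {eX : Additive ↥(characterLattice T) ≃+ X}
  {eY : Additive ↥(cocharacterLattice T) ≃+ Y}

/-- The pairing of the root `α_i` with the cocharacter `λ_y` of a coweight `y` is `⟨α_i, y⟩`.
[folklore] -/
lemma IsRootDatumOf.charPairingInt_charOfWeight_cocharOfCoweight (h : IsRootDatumOf G T P eX eY)
    (i : ι) (y : Y) :
    charPairingInt (charOfWeight eX (P.root i)) (cocharOfCoweight eY y) = P.root' i y := by
  have e := h.pairing_eq (Additive.toMul (eX.symm (P.root i))) (Additive.toMul (eY.symm y))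
  simp only [ofMul_toMul, AddEquiv.apply_symm_apply] at e
  exact e.symm

/-- **`U(y)` is block upper unipotent in a frame diagonalising `T`** (each generator `u_i(x)`,
`⟨α_i, y⟩ > 0`, is, by `IsRootHom.isBlockUpperUnipotent_conj`, and these matrices form a group).
[folklore] -/
theorem isBlockUpperUnipotent_conj_of_mem_posRootGroup [Infinite k] (h : IsRootDatumOf G T P eX eY)
    {u : ι → Multiplicative k →* ↥G} (hu : ∀ i, IsRootHom G T h.le (charOfWeight eX (P.root i)) (u i))
    (y : Y) (A : GL n k) (hA : T.map (MulAut.conj A).toMonoidHom ≤ diagonalSubgroup n k)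
    {g : GL n k} (hg : g ∈ posRootGroup G P u y) :
    IsBlockUpperUnipotent (fun j => -cocharWeight A hA (cocharOfCoweight eY y) j)
      ((A * g * A⁻¹ : GL n k) : Matrix n n k) := by
  have hγ : IsAlgebraicCochar (cocharOfCoweight eY y) := (Additive.toMul (eY.symm y)).2
  have halg : ∀ i, IsAlgebraicChar (charOfWeight eX (P.root i)) := fun i =>
    (Additive.toMul (eX.symm (P.root i))).2
  have hle : posRootGroup G P u y ≤
      (blockUpperUnipotentGL k fun j => -cocharWeight A hA (cocharOfCoweight eY y) j).comap
        (MulAut.conj A).toMonoidHom := by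
    refine iSup_le fun i => ?_
    rintro _ ⟨_, ⟨x, rfl⟩, rfl⟩
    rw [Subgroup.mem_comap, mem_blockUpperUnipotentGL]
    have hpos : 0 < charPairingInt (charOfWeight eX (P.root i.1)) (cocharOfCoweight eY y) := by
      rw [h.charPairingInt_charOfWeight_cocharOfCoweight]; exact i.2
    have := (hu i.1).isBlockUpperUnipotent_conj (halg i.1) hγ A hA hpos (Multiplicative.toAdd x)
    simpa using this
  exact hle hg

/-- For `B ∈ Lie(U(y))`, the conjugate `A B A⁻¹` is strictly block upper triangular: its entry
`(p, q)` vanishes unless `-m_p < -m_q` (differentiate the polynomial identities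
`(A g A⁻¹)_{pq} = δ_{pq}` satisfied by `U(y)`). [folklore] -/
theorem conj_apply_eq_zero_of_mem_lieAlgebraGL_posRootGroup [Infinite k]
    (h : IsRootDatumOf G T P eX eY) {u : ι → Multiplicative k →* ↥G}
    (hu : ∀ i, IsRootHom G T h.le (charOfWeight eX (P.root i)) (u i)) (y : Y) (A : GL n k)
    (hA : T.map (MulAut.conj A).toMonoidHom ≤ diagonalSubgroup n k) {B : Matrix n n k}
    (hB : B ∈ lieAlgebraGL (posRootGroup G P u y)) {p q : n}
    (hpq : ¬ -cocharWeight A hA (cocharOfCoweight eY y) p < -cocharWeight A hA (cocharOfCoweight eY y) q) :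
    ((A : Matrix n n k) * B * ((A⁻¹ : GL n k) : Matrix n n k)) p q = 0 := by
  set b : n → ℤ := fun j => -cocharWeight A hA (cocharOfCoweight eY y) j with hb
  have hmem : conjPolyGL A A⁻¹ (Sum.inl (p, q)) - MvPolynomial.C ((1 : Matrix n n k) p q) ∈
      MvPolynomial.vanishingIdeal k (glCoordFun '' (posRootGroup G P u y : Set (GL n k))) := by
    rw [mem_vanishingIdeal_glCoordFun_iff]
    intro g hg
    rw [map_sub, MvPolynomial.eval_C, eval_conjPolyGL, glCoordFun_inl, sub_eq_zero]
    obtain ⟨hbt, hdiag⟩ := isBlockUpperUnipotent_conj_of_mem_posRootGroup h hu y A hA hg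
    rcases lt_trichotomy (b p) (b q) with hlt | heq | hgt
    · exact absurd hlt hpq
    · exact hdiag p q heq
    · rw [hbt hgt, Matrix.one_apply, if_neg]
      rintro rfl
      exact lt_irrefl _ hgt
  have h0 := (mem_lieAlgebraGL_iff.1 hB) _ hmem
  rw [tangentDeriv_sub, tangentDeriv_C, sub_zero, tangentDeriv, aeval_dualPoint_conjPolyGL,
    snd_dualPoint] at h0
  exact h0

/-- **The Lie algebra of `U(y)` lies in the sum of the root spaces of the `y`-positive roots**
(characteristic `0`). Let `G ≤ GL n k` be algebraic over an algebraically closed field of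
characteristic `0`, `T ≤ G` a torus, `P` a root datum of `(G, T)` with root homomorphisms `u_i`
and `y` a coweight. Then `Lie(U(y)) ⊆ ⨁_{⟨α_i, y⟩ > 0} 𝔤_{α_i}` for
`U(y) = ⟨u_i(𝔾ₐ) : ⟨α_i, y⟩ > 0⟩` (Springer 8.2.1–8.2.2: `L(B_u) = ⨁_{α > 0} 𝔤_α`; 8.1.3 (i):
`U_α ⊂ B ⇔ 𝔤_α ⊂ 𝔟`). Proof: `Lie(U(y))` is `Ad(T)`-stable (`T` normalises `U(y)`), hence the
sum of its weight components (7.1.1, `iSup_inf_adWeightSpace_eq`); a non-zero component has an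
algebraic weight `χ`; in a frame `A` diagonalising `T`, `U(y)` is block upper unipotent for the
weights `m` of `λ_y` (`IsRootHom.isBlockUpperUnipotent_conj`), so a non-zero entry `(p, q)` of
`A B A⁻¹` has `m_p > m_q`, while the torus relation gives `χ = χ_p χ_q⁻¹` for the coordinate
characters, whence `⟨χ, y⟩ = m_p - m_q > 0`; in particular `χ ≠ 1` is a non-zero weight of `T`
in `Lie(G)`, hence a root (`lieWeights_subset_roots`, characteristic `0`), i.e. `χ = α_i` with
`⟨α_i, y⟩ > 0`. [cite: SpringerLAG1998, 8.2.1 and 8.1.3 (i)] -/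
theorem lieAlgebraGL_posRootGroup_le [IsAlgClosed k] [CharZero k] (hG : IsAlgebraicSubgroup G)
    (hT : IsTorusSubgroup T) (h : IsRootDatumOf G T P eX eY) (u : ι → Multiplicative k →* ↥G)
    (hu : ∀ i, IsRootHom G T h.le (charOfWeight eX (P.root i)) (u i)) (y : Y) :
    lieAlgebraGL (posRootGroup G P u y) ≤
      ⨆ i : {i : ι // 0 < P.root' i y}, lieWeightSpace G T (charOfWeight eX (P.root i.1)) := by
  classical
  obtain ⟨A, hA⟩ := exists_conj_le_diagonalSubgroup hT.2.1 hT.2.2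
  have hA' : T.map (MulAut.conj A : GL n k →* GL n k) ≤ diagonalSubgroup n k := hA
  set γ : kˣ →* ↥T := cocharOfCoweight eY y with hγdef
  have hγ : IsAlgebraicCochar γ := (Additive.toMul (eY.symm y)).2
  set m : n → ℤ := cocharWeight A hA' γ with hmdef
  -- `Lie(U(y))` is `Ad(T)`-stable and lies in `Lie(G)`
  set W := lieAlgebraGL (posRootGroup G P u y) with hWdef
  have hWT : ∀ t : ↥T, ∀ B ∈ W, adGL (t : GL n k) B ∈ W := by
    intro t B hB
    rw [adGL_apply]
    exact conj_mem_lieAlgebraGL_of_forall_mem (fun x hx => conj_mem_posRootGroup h hu y t.2 hx) hB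
  have hWG : W ≤ lieAlgebraGL G := lieAlgebraGL_mono (posRootGroup_le P u y)
  -- decompose into weight components
  rw [← iSup_inf_adWeightSpace_eq T hT.2.2 W hWT]
  refine iSup_le fun w => ?_
  by_cases hbot : W ⊓ adWeightSpace T w = ⊥
  · rw [hbot]; exact bot_le
  obtain ⟨B, ⟨hBW, hBw⟩, hB0⟩ := (Submodule.ne_bot_iff _).1 hbot
  -- the weight is an algebraic character `χ`
  have hχalg : IsAlgebraicChar (adWeightChar hBw hB0) := isAlgebraicChar_adWeightChar hBw hB0
  set χ : ↥(characterLattice T) := ⟨adWeightChar hBw hB0, hχalg⟩ with hχdef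
  have hwχ : adWeightSpace T w = weightSpaceGL T (χ : ↥T →* kˣ) := by
    rw [weightSpaceGL_eq_adWeightSpace]
    rfl
  -- a non-zero entry of `C = A B A⁻¹`
  set C : Matrix n n k := (A : Matrix n n k) * B * ((A⁻¹ : GL n k) : Matrix n n k) with hCdef
  have hC0 : C ≠ 0 := by
    intro hC
    apply hB0
    have : B = ((A⁻¹ : GL n k) : Matrix n n k) * C * (A : Matrix n n k) := by
      rw [hCdef]
      simp [Matrix.mul_assoc]
    rw [this, hC, Matrix.mul_zero, Matrix.zero_mul]
  obtain ⟨p, q, hCpq⟩ : ∃ p q, C p q ≠ 0 := by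
    by_contra hall
    push Not at hall
    exact hC0 (Matrix.ext fun p q => by rw [hall p q]; rfl)
  have hbpq : -m p < -m q := by
    by_contra hn
    exact hCpq (conj_apply_eq_zero_of_mem_lieAlgebraGL_posRootGroup h hu y A hA' hBW hn)
  -- the coordinate characters of the diagonal frame
  set χd : n → (↥T →* kˣ) := fun r => (diagEntryChar hA' r).comp (conjEquiv A T).toMonoidHom
    with hχddef
  have hχd : ∀ r, IsAlgebraicChar (χd r) := fun r =>
    (isAlgebraicChar_diagEntryChar hA' r).comp_conjEquiv A
  have hmχd : ∀ r, charPairingInt (χd r) γ = m r := fun r =>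
    charPairingInt_comp_conjEquiv A (diagEntryChar hA' r) γ
  -- torus relation conjugated by `A`: `χd p t · C_pq · (χd q t)⁻¹ = χ t · C_pq`
  have hrel : ∀ t : ↥T,
      ((χd p t : kˣ) : k) * C p q * (((χd q t : kˣ) : k))⁻¹ = (((χ : ↥T →* kˣ) t : kˣ) : k) * C p q := by
    intro t
    have hBt : ((t : GL n k) : Matrix n n k) * B * (((t : GL n k)⁻¹ : GL n k) : Matrix n n k) =
        (((χ : ↥T →* kˣ) t : kˣ) : k) • B := by
      rw [mem_adWeightSpace_iff.1 hBw t]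
      rfl
    have e1 : ((A * (t : GL n k) * A⁻¹ : GL n k) : Matrix n n k) * C *
        ((A * ((t⁻¹ : ↥T) : GL n k) * A⁻¹ : GL n k) : Matrix n n k) =
        (A : Matrix n n k) * (((t : GL n k) : Matrix n n k) * B *
          (((t : GL n k)⁻¹ : GL n k) : Matrix n n k)) * ((A⁻¹ : GL n k) : Matrix n n k) := by
      simp only [hCdef, Units.val_mul, Subgroup.coe_inv, Matrix.mul_assoc, Units.inv_mul_cancel_left]
    have kmat : ((A * (t : GL n k) * A⁻¹ : GL n k) : Matrix n n k) * C *
        ((A * ((t⁻¹ : ↥T) : GL n k) * A⁻¹ : GL n k) : Matrix n n k) =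
        (((χ : ↥T →* kˣ) t : kˣ) : k) • C := by
      rw [e1, hBt, Matrix.mul_smul, Matrix.smul_mul, ← hCdef]
    rw [conj_torus_eq_diagonal A hA' t, conj_torus_inv_eq_diagonal A hA' t] at kmat
    have kij := congr_fun (congr_fun kmat p) q
    rw [Matrix.mul_diagonal, Matrix.diagonal_mul, Matrix.smul_apply, smul_eq_mul] at kij
    exact kij
  -- hence `χ = χd p · (χd q)⁻¹` and `⟨χ, y⟩ = m p - m q > 0`
  have hχeq : (χ : ↥T →* kˣ) = χd p * (χd q)⁻¹ := by
    refine MonoidHom.ext fun t => Units.ext ?_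
    rw [MonoidHom.mul_apply, MonoidHom.inv_apply, Units.val_mul, Units.val_inv_eq_inv_val]
    have e := hrel t
    rw [mul_right_comm] at e
    exact (mul_right_cancel₀ hCpq e).symm
  have hpos : 0 < charPairingInt (χ : ↥T →* kˣ) γ := by
    rw [hχeq, charPairingInt_mul_left (hχd p) (hχd q).inv hγ, charPairingInt_inv_left (hχd q) hγ,
      hmχd, hmχd]
    omega
  -- `χ` is a non-zero weight, hence a root `α_i` with `⟨α_i, y⟩ > 0`
  have hχ1 : (χ : ↥T →* kˣ) ≠ 1 := by
    intro h1
    rw [h1, charPairingInt_one_left hγ] at hpos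
    exact lt_irrefl _ hpos
  have hχP : χ ∈ lieWeights G T :=
    mem_lieWeights_iff.2 ⟨hχ1, B, hWG hBW, hB0, by rw [← hwχ]; exact hBw⟩
  have hχR : χ ∈ roots G T := lieWeights_subset_roots hG hT.1 h.le hχP
  obtain ⟨i, hi⟩ : ∃ i, P.root i = eX (Additive.ofMul χ) := by
    have hmem : eX (Additive.ofMul χ) ∈ Set.range P.root := by
      rw [h.range_root]; exact ⟨χ, hχR, rfl⟩
    exact hmem
  have hαi : charOfWeight eX (P.root i) = (χ : ↥T →* kˣ) := by
    simp [charOfWeight, hi]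
  have hipos : 0 < P.root' i y := by
    rw [← h.charPairingInt_charOfWeight_cocharOfCoweight i y, hαi]
    exact hpos
  -- the component lies in `𝔤_{α_i}`
  refine le_iSup_of_le ⟨i, hipos⟩ ?_
  rintro B' ⟨hB'W, hB'w⟩
  refine ⟨hWG hB'W, ?_⟩
  change B' ∈ weightSpaceGL T (charOfWeight eX (P.root i))
  rw [hαi, ← hwχ]
  exact hB'w

/-- **`dim U(y) ≤ |R⁺(y)|` when the root spaces are lines** (characteristic `0`): with
`Lie(U(y)) ⊆ ⨁_{⟨α_i, y⟩ > 0} 𝔤_{α_i}` (`lieAlgebraGL_posRootGroup_le`), `dim 𝔤_{α_i} ≤ 1`, and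
`dim U(y) = dim Lie(U(y))` (4.4.6, `U(y)` being a connected algebraic subgroup,
`isZConnected_posRootGroup`), the dimension of `U(y)` is at most the number of `y`-positive
roots (Springer 8.2.4, proof: "`dim U_n = |R̃⁺_n|`"; 8.1.3 (ii): `dim B = r + ½|R|`).
[cite: SpringerLAG1998, 8.2.4 (proof) and 8.1.3 (ii)] -/
theorem zdim_posRootGroup_le [IsAlgClosed k] [CharZero k] [Fintype ι] (hG : IsAlgebraicSubgroup G)
    (hT : IsTorusSubgroup T) (h : IsRootDatumOf G T P eX eY) (u : ι → Multiplicative k →* ↥G)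
    (hu : ∀ i, IsRootHom G T h.le (charOfWeight eX (P.root i)) (u i)) (y : Y)
    (hdim : ∀ i, Module.finrank k ↥(lieWeightSpace G T (charOfWeight eX (P.root i))) ≤ 1) :
    (isZConnected_posRootGroup (P := P) hG hu y).zdim ≤
      (Finset.univ.filter fun i => 0 < P.root' i y).card := by
  classical
  have hU := isZConnected_posRootGroup (P := P) hG hu y
  have hfin := hU.finrank_lieAlgebraGL_eq
  rw [← hfin.2]
  haveI := hfin.1
  -- the family of positive root spaces is independent
  let Nf : {i : ι // 0 < P.root' i y} → Submodule k (Matrix n n k) := fun i =>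
    lieWeightSpace G T (charOfWeight eX (P.root i.1))
  have hind : iSupIndep Nf := by
    let wt : {i : ι // 0 < P.root' i y} → (↥T → k) := fun i t =>
      ((charOfWeight eX (P.root i.1) t : kˣ) : k)
    have hwt : Function.Injective wt := by
      intro i j hij
      have hc : charOfWeight eX (P.root i.1) = charOfWeight eX (P.root j.1) :=
        MonoidHom.ext fun t => Units.ext (congrFun hij t)
      exact Subtype.ext (P.root.injective (charOfWeight_injective eX hc))
    refine ((iSupIndep_adWeightSpace T hT.2.2).comp hwt).mono fun i => ?_
    change lieWeightSpace G T (charOfWeight eX (P.root i.1)) ≤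
      adWeightSpace T fun t => ((charOfWeight eX (P.root i.1) t : kˣ) : k)
    rw [← weightSpaceGL_eq_adWeightSpace]
    exact inf_le_right
  have hle := lieAlgebraGL_posRootGroup_le hG hT h u hu y
  have hsup : (⨆ i : {i : ι // 0 < P.root' i y}, Nf i) = ⨆ i ∈ (Finset.univ : Finset _), Nf i := by
    simp
  calc Module.finrank k ↥(lieAlgebraGL (posRootGroup G P u y))
      ≤ Module.finrank k ↥(⨆ i : {i : ι // 0 < P.root' i y}, Nf i) := Submodule.finrank_mono hle
    _ = ∑ i ∈ (Finset.univ : Finset {i : ι // 0 < P.root' i y}), Module.finrank k ↥(Nf i) := by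
        rw [hsup]; exact finrank_biSup_eq_sum_of_iSupIndep' hind _
    _ ≤ ∑ _i ∈ (Finset.univ : Finset {i : ι // 0 < P.root' i y}), 1 :=
        Finset.sum_le_sum fun i _ => hdim i.1
    _ = (Finset.univ.filter fun i => 0 < P.root' i y).card := by
        rw [Finset.sum_const, smul_eq_mul, mul_one, Finset.card_univ, Fintype.card_subtype]

end LiePosRootGroup

end Literature.NumberTheory.Automorphic

/-!
## Part II. `U(y)` is the product of its root subgroups (Springer 8.2.1) by a dimension count
-/

noncomputable section

open scoped MatrixGroups IsMulCommutative
open Polynomial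

namespace Literature.NumberTheory.Automorphic

variable {k : Type*} [Field k] {n : Type*} [Fintype n] [DecidableEq n]

/-! ### Dimension of a closed subset with prime ideal, inside a connected group -/

section SetDimension

/-- **A proper closed subset `Z` of a connected algebraic group `G` with prime vanishing ideal has
smaller dimension**: `dim k[x, y]/𝓘(Z) < dim G` (Springer 1.8.2; the variant of
`ringKrullDim_quotient_lt_zdim` of `BigCellOpen.lean` with the primality of `𝓘(Z)` as hypothesis
instead of the irreducibility of `Z`). [cite: SpringerLAG1998, Prop 1.8.2] -/
theorem ringKrullDim_quotient_lt_zdim_of_isPrime {G : Subgroup (GL n k)} (hG : IsZConnected G)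
    {Z : Set (GL n k)} {S : Set (MvPolynomial (GLCoord n) k)} (hZS : Z = zeroLocusGL S)
    (hZp : (idealSetGL Z).IsPrime) (hZG : Z ⊆ G) (hne : Z ≠ (G : Set (GL n k))) :
    ringKrullDim (MvPolynomial (GLCoord n) k ⧸ idealSetGL Z) < ((hG.zdim : ℕ∞) : WithBot ℕ∞) := by
  let pZ : PrimeSpectrum (MvPolynomial (GLCoord n) k) := ⟨idealSetGL Z, hZp⟩
  have hlt : hG.primePoint < pZ := by
    rw [← PrimeSpectrum.asIdeal_lt_asIdeal, IsZConnected.primePoint_asIdeal]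
    refine lt_of_le_of_ne (MvPolynomial.vanishingIdeal_anti_mono (Set.image_mono hZG)) fun hEq => ?_
    obtain ⟨S', hS'⟩ := hG.1
    exact hne (eq_of_vanishingIdeal_eq hZS hS' hEq.symm)
  have hfin : Order.coheight pZ < ⊤ := by
    have h1 := Order.coheight_le_krullDim pZ
    have h2 : Order.krullDim (PrimeSpectrum (MvPolynomial (GLCoord n) k)) =
        (Nat.card (GLCoord n) : WithBot ℕ∞) := ringKrullDim_mvPolynomial_glCoord
    rw [h2] at h1
    have h3 : Order.coheight pZ ≤ (Nat.card (GLCoord n) : ℕ∞) := by exact_mod_cast h1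
    exact lt_of_le_of_lt h3 (ENat.coe_lt_top _)
  have hco : Order.coheight pZ < Order.coheight hG.primePoint := Order.coheight_strictAnti hlt hfin
  have hdim : ringKrullDim (MvPolynomial (GLCoord n) k ⧸ idealSetGL Z) =
      ((Order.coheight pZ : ℕ∞) : WithBot ℕ∞) := by
    rw [Order.coheight_eq_krullDim_Ici, ringKrullDim_quotient]
    have hset : PrimeSpectrum.zeroLocus (R := MvPolynomial (GLCoord n) k) ↑(idealSetGL Z) =
        Set.Ici pZ := by
      ext q
      rw [PrimeSpectrum.mem_zeroLocus, Set.mem_Ici, ← PrimeSpectrum.asIdeal_le_asIdeal]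
      rfl
    rw [hset]
  rw [hdim, hG.coe_zdim]
  exact_mod_cast hco

end SetDimension

/-! ### The ordered product of root homomorphisms as a polynomial map -/

section RootProd

variable {ι : Type*} {G : Subgroup (GL n k)}

/-- The ordered product `φ_l(x) = ∏_{i ∈ l} u_i(x_i) ∈ GL n k` (Springer 8.2.1: the morphism
`φ : 𝔾ₐ^m → B_u`). [folklore] -/
def rootProd (u : ι → Multiplicative k →* ↥G) (l : List ι) (x : ι → k) : GL n k :=
  (l.map fun i => ((u i (Multiplicative.ofAdd (x i)) : ↥G) : GL n k)).prod

/-- `φ_l(x)` only depends on the coordinates `x_i`, `i ∈ l`. [folklore] -/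
lemma rootProd_congr (u : ι → Multiplicative k →* ↥G) (l : List ι) {x x' : ι → k}
    (hx : ∀ i ∈ l, x i = x' i) : rootProd u l x = rootProd u l x' := by
  unfold rootProd
  rw [List.map_congr_left fun i hi => by rw [hx i hi]]

/-- `φ_l(x) ∈ ⟨u_i(𝔾ₐ) : i ∈ l⟩`, in particular `φ_l(x) ∈ U(y)` when `l` lists `y`-positive
roots. [folklore] -/
lemma rootProd_mem {H : Subgroup (GL n k)} (u : ι → Multiplicative k →* ↥G) {l : List ι}
    (hl : ∀ i ∈ l, ∀ z : Multiplicative k, ((u i z : ↥G) : GL n k) ∈ H) (x : ι → k) :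
    rootProd u l x ∈ H := by
  unfold rootProd
  refine H.list_prod_mem ?_
  intro g hg
  rw [List.mem_map] at hg
  obtain ⟨i, hi, rfl⟩ := hg
  exact hl i hi _

/-- The coordinates of `φ_l(x)` as polynomials in `x`, in terms of the coordinate polynomials
`Pu i` of the `u_i`: the entries of the matrix product `∏ M_i(X_i)` (`prodPolyMat`, with `M_i` the
entry polynomials of `u_i`) and the constant `1` for `det⁻¹`. [folklore] -/
def rootProdPoly (Pu : ι → GLCoord n → k[X]) (l : List ι) : GLCoord n → MvPolynomial ι k
  | Sum.inl pq => prodPolyMat (fun i a b => Pu i (Sum.inl (a, b))) l pq.1 pq.2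
  | Sum.inr _ => 1

variable {u : ι → Multiplicative k →* ↥G} {Pu : ι → GLCoord n → k[X]}

/-- `rootProdPoly` evaluates to the coordinates of `φ_l(x)`. [folklore] -/
theorem eval_rootProdPoly [Infinite k]
    (hPu : ∀ (i : ι) (x : k) (c : GLCoord n),
      glCoordFun ((u i (Multiplicative.ofAdd x) : ↥G) : GL n k) c = (Pu i c).eval x)
    (l : List ι) (x : ι → k) (c : GLCoord n) :
    MvPolynomial.eval x (rootProdPoly Pu l c) = glCoordFun (rootProd u l x) c := by
  -- the matrix of `φ_l(x)` is `prodMat`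
  have hmat : ((rootProd u l x : GL n k) : Matrix n n k) =
      prodMat (fun i a b => Pu i (Sum.inl (a, b))) l x := by
    rw [rootProd, ← Units.coeHom_apply, map_list_prod, List.map_map, prodMat]
    congr 1
    refine List.map_congr_left fun i _ => ?_
    ext a b
    simp only [Function.comp_apply, Units.coeHom_apply, Matrix.of_apply]
    rw [← hPu i (x i) (Sum.inl (a, b)), glCoordFun_inl]
  rcases c with ⟨a, b⟩ | uu
  · rw [rootProdPoly, eval_prodPolyMat, glCoordFun_inl, hmat]
  · rw [rootProdPoly, map_one, glCoordFun_inr]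
    have hdet : Matrix.det ((rootProd u l x : GL n k) : Matrix n n k) = 1 := by
      rw [rootProd, ← Units.coeHom_apply, map_list_prod, ← Matrix.coe_detMonoidHom,
        map_list_prod, List.map_map, List.map_map]
      apply List.prod_eq_one
      intro d hd
      rw [List.mem_map] at hd
      obtain ⟨i, -, rfl⟩ := hd
      simp only [Function.comp_apply, Matrix.coe_detMonoidHom, Units.coeHom_apply]
      exact IsAlgebraicAddHom.det_eq_one ⟨Pu i, hPu i⟩ (x i)
    rw [hdet, inv_one]

variable (Pu) in
/-- The comorphism `Φ_l : k[x_{pq}, y] → k[X_ι]`, `p ↦ p ∘ φ_l` (in terms of the coordinate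
polynomials `Pu i` of the `u_i`). [folklore] -/
def rootProdHom (l : List ι) : MvPolynomial (GLCoord n) k →ₐ[k] MvPolynomial ι k :=
  MvPolynomial.aeval (rootProdPoly Pu l)

/-- `(Φ_l p)(x) = p(φ_l(x))`. [folklore] -/
theorem eval_rootProdHom [Infinite k]
    (hPu : ∀ (i : ι) (x : k) (c : GLCoord n),
      glCoordFun ((u i (Multiplicative.ofAdd x) : ↥G) : GL n k) c = (Pu i c).eval x)
    (l : List ι) (x : ι → k) (p : MvPolynomial (GLCoord n) k) :
    MvPolynomial.eval x (rootProdHom Pu l p) = MvPolynomial.eval (glCoordFun (rootProd u l x)) p := by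
  rw [rootProdHom, MvPolynomial.aeval_eq_bind₁, eval_bind₁]
  have hf : (fun i => MvPolynomial.eval x (rootProdPoly Pu l i)) = glCoordFun (rootProd u l x) :=
    funext fun c => eval_rootProdPoly hPu l x c
  rw [hf]

/-- **The kernel of `Φ_l` is the ideal of the image `Z = φ_l(k^ι)`** (a polynomial vanishes on the
image iff its composite with `φ_l` vanishes identically, `k` being infinite). [folklore] -/
theorem ker_rootProdHom_eq [Infinite k]
    (hPu : ∀ (i : ι) (x : k) (c : GLCoord n),
      glCoordFun ((u i (Multiplicative.ofAdd x) : ↥G) : GL n k) c = (Pu i c).eval x)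
    (l : List ι) :
    RingHom.ker (rootProdHom Pu l) = idealSetGL (Set.range (rootProd u l)) := by
  ext p
  rw [RingHom.mem_ker, mem_idealSetGL_iff]
  constructor
  · rintro hp _ ⟨x, rfl⟩
    rw [← eval_rootProdHom hPu, hp, map_zero]
  · intro hp
    apply MvPolynomial.funext
    intro x
    rw [eval_rootProdHom hPu, map_zero]
    exact hp _ ⟨x, rfl⟩

/-- The range of `Φ_l` lies in the polynomials in the variables `X_i`, `i ∈ l`. [folklore] -/
theorem rootProdHom_mem_supported [DecidableEq ι] (l : List ι) (p : MvPolynomial (GLCoord n) k) :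
    rootProdHom Pu l p ∈ MvPolynomial.supported k (↑l.toFinset : Set ι) := by
  rw [rootProdHom]
  induction p using MvPolynomial.induction_on with
  | C a => rw [MvPolynomial.aeval_C]; exact Subalgebra.algebraMap_mem _ a
  | add p q hp hq => rw [map_add]; exact Subalgebra.add_mem _ hp hq
  | mul_X p c hp =>
    rw [map_mul, MvPolynomial.aeval_X]
    refine Subalgebra.mul_mem _ hp ?_
    rw [MvPolynomial.mem_supported]
    rcases c with ⟨a, b⟩ | uu
    · exact_mod_cast vars_prodPolyMat_subset (fun i a b => Pu i (Sum.inl (a, b))) l a b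
    · simp [rootProdPoly]

/-- **With a polynomial left inverse `q` (`q_i(φ_l(x)) = x_i`, `i ∈ l`), the range of `Φ_l` is
exactly `k[X_i : i ∈ l]`** (`X_i = Φ_l(q_i)`). [folklore] -/
theorem range_rootProdHom_eq [Infinite k] [DecidableEq ι]
    (hPu : ∀ (i : ι) (x : k) (c : GLCoord n),
      glCoordFun ((u i (Multiplicative.ofAdd x) : ↥G) : GL n k) c = (Pu i c).eval x)
    (l : List ι) {q : ι → MvPolynomial (GLCoord n) k}
    (hq : ∀ (x : ι → k), ∀ i ∈ l, MvPolynomial.eval (glCoordFun (rootProd u l x)) (q i) = x i) :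
    (rootProdHom Pu l).range = MvPolynomial.supported k (↑l.toFinset : Set ι) := by
  refine le_antisymm ?_ ?_
  · rintro _ ⟨p, rfl⟩
    exact rootProdHom_mem_supported l p
  · rw [MvPolynomial.supported, Algebra.adjoin_le_iff]
    rintro _ ⟨i, hi, rfl⟩
    refine ⟨q i, MvPolynomial.funext fun x => ?_⟩
    change MvPolynomial.eval x (rootProdHom Pu l (q i)) = MvPolynomial.eval x (MvPolynomial.X i)
    rw [eval_rootProdHom hPu, MvPolynomial.eval_X]
    exact hq x i (by simpa using hi)

/-- **The coordinate ring of the image `Z = φ_l(k^ι)` is a polynomial ring in `|l|` variables**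
(granted the polynomial left inverse): `k[x, y]/𝓘(Z) ≅ k[X_i : i ∈ l]`, so `𝓘(Z)` is prime and
`dim k[Z] = |l|`. [folklore] -/
theorem ringKrullDim_quotient_idealSetGL_range_rootProd [Infinite k] [DecidableEq ι]
    (hPu : ∀ (i : ι) (x : k) (c : GLCoord n),
      glCoordFun ((u i (Multiplicative.ofAdd x) : ↥G) : GL n k) c = (Pu i c).eval x)
    (l : List ι) (hl : l.Nodup) {q : ι → MvPolynomial (GLCoord n) k}
    (hq : ∀ (x : ι → k), ∀ i ∈ l, MvPolynomial.eval (glCoordFun (rootProd u l x)) (q i) = x i) :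
    (idealSetGL (Set.range (rootProd u l))).IsPrime ∧
      ringKrullDim (MvPolynomial (GLCoord n) k ⧸ idealSetGL (Set.range (rootProd u l))) =
        (l.length : WithBot ℕ∞) := by
  have hker := ker_rootProdHom_eq hPu l
  refine ⟨?_, ?_⟩
  · rw [← hker]; exact RingHom.ker_isPrime _
  · -- `k[Z] ≅ range Φ_l ≅ supported ≅ MvPolynomial {i ∈ l}`
    set Φ := rootProdHom Pu l with hΦ
    have e₁ : (MvPolynomial (GLCoord n) k ⧸ idealSetGL (Set.range (rootProd u l))) ≃ₐ[k] Φ.range :=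
      (Ideal.quotientEquivAlgOfEq k (by rw [← hker, AlgHom.ker_rangeRestrict])).trans
        (Ideal.quotientKerAlgEquivOfSurjective Φ.rangeRestrict_surjective)
    have e₂ : Φ.range ≃ₐ[k] MvPolynomial (↥(↑l.toFinset : Set ι)) k :=
      (Subalgebra.equivOfEq _ _ (range_rootProdHom_eq hPu l hq)).trans
        (MvPolynomial.supportedEquivMvPolynomial _)
    rw [ringKrullDim_eq_of_ringEquiv (e₁.trans e₂).toRingEquiv,
      MvPolynomial.ringKrullDim_of_isNoetherianRing, ringKrullDim_eq_zero_of_field, zero_add]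
    congr 1
    rw [Nat.card_coe_set_eq, Set.ncard_coe_finset, List.toFinset_card_of_nodup hl]

/-- **The image `Z = φ_l(k^ι)` is closed when `φ_l` has a polynomial left inverse `q`**:
`Z = {g | φ_l(q(g)) = g}`. [folklore] -/
theorem range_rootProd_eq_zeroLocusGL [Infinite k]
    (hPu : ∀ (i : ι) (x : k) (c : GLCoord n),
      glCoordFun ((u i (Multiplicative.ofAdd x) : ↥G) : GL n k) c = (Pu i c).eval x)
    (l : List ι) {q : ι → MvPolynomial (GLCoord n) k}
    (hq : ∀ (x : ι → k), ∀ i ∈ l, MvPolynomial.eval (glCoordFun (rootProd u l x)) (q i) = x i) :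
    Set.range (rootProd u l) = zeroLocusGL (Set.range fun c : GLCoord n =>
      MvPolynomial.bind₁ q (rootProdPoly Pu l c) - MvPolynomial.X c) := by
  have key : ∀ g : GL n k, g ∈ zeroLocusGL (Set.range fun c : GLCoord n =>
      MvPolynomial.bind₁ q (rootProdPoly Pu l c) - MvPolynomial.X c) ↔
        rootProd u l (fun i => MvPolynomial.eval (glCoordFun g) (q i)) = g := by
    intro g
    simp only [zeroLocusGL, Set.mem_setOf_eq, Set.forall_mem_range, map_sub, MvPolynomial.eval_X,
      sub_eq_zero, eval_bind₁, eval_rootProdPoly hPu]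
    constructor
    · intro hg
      exact glCoordFun_injective (funext hg)
    · intro hg c
      rw [hg]
  ext g
  rw [key]
  constructor
  · rintro ⟨x, rfl⟩
    exact rootProd_congr u l fun i hi => hq x i hi
  · intro hg
    exact ⟨_, hg⟩

end RootProd

/-! ### Springer 8.2.1 (surjectivity) by a dimension count -/

section Surjectivity

variable {ι X Y : Type*} [AddCommGroup X] [AddCommGroup Y]
variable {G T : Subgroup (GL n k)} [IsMulCommutative ↥T]
variable {P : RootPairing ι ℤ X Y} {eX : Additive ↥(characterLattice T) ≃+ X}
  {eY : Additive ↥(cocharacterLattice T) ≃+ Y}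

/-- **`U(y) = ∏_{i ∈ l} U_{α_i}` when the root spaces are lines (characteristic `0`).** Let
`G ≤ GL n k` be algebraic over an algebraically closed field of characteristic `0`, `T ≤ G` a
torus, `P` a root datum of `(G, T)` (finitely many roots) with root homomorphisms `u_i`, `y` a
coweight, `l` a numbering of the `y`-positive roots, and suppose `dim 𝔤_{α_i} ≤ 1` for all `i`.
Then every element of `U(y) = ⟨u_i(𝔾ₐ) : ⟨α_i, y⟩ > 0⟩` is an ordered product
`∏_{i ∈ l} u_i(x_i)` — the surjectivity half of Springer 8.2.1 (*"the morphism
`φ : 𝔾ₐ^m → B_u` … is an isomorphism of varieties"*). Proof by dimensions, in place of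
Springer's 8.2.2 (quotients by central `𝔾ₐ`'s) and of the route through the commutator
relations 8.2.3 (`posRootGroup_eq_prod_of`, `PosRootGroupProduct.lean`): the image
`Z = φ_l(k^m)` is closed with coordinate ring `k[Z] ≅ k[X_1, …, X_m]` (polynomial left inverse,
`exists_polyRetraction_prod_rootHom`), so `𝓘(Z)` is prime and `dim k[Z] = m`; `U(y)` is a
connected algebraic group of dimension `≤ m` (`zdim_posRootGroup_le`); if `Z ⊊ U(y)` then
`dim k[Z] < dim U(y) ≤ m` (1.8.2), absurd. [cite: SpringerLAG1998, Prop 8.2.1] -/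
theorem posRootGroup_subset_range_rootProd [IsAlgClosed k] [CharZero k] [Fintype ι]
    (hG : IsAlgebraicSubgroup G) (hT : IsTorusSubgroup T) (h : IsRootDatumOf G T P eX eY)
    (u : ι → Multiplicative k →* ↥G) (hu : ∀ i, IsRootHom G T h.le (charOfWeight eX (P.root i)) (u i))
    (y : Y) (l : List ι) (hl : l.Nodup) (hl' : ∀ i, i ∈ l ↔ 0 < P.root' i y)
    (hdim : ∀ i, Module.finrank k ↥(lieWeightSpace G T (charOfWeight eX (P.root i))) ≤ 1) :
    (posRootGroup G P u y : Set (GL n k)) ⊆ Set.range (rootProd u l) := by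
  classical
  -- polynomial data
  choose Pu hPu using fun i => (hu i).1
  obtain ⟨q, hq⟩ := exists_polyRetraction_prod_rootHom hT h u hu y l hl fun i hi => (hl' i).mp hi
  have hq' : ∀ (x : ι → k), ∀ i ∈ l, MvPolynomial.eval (glCoordFun (rootProd u l x)) (q i) = x i :=
    hq
  set Z : Set (GL n k) := Set.range (rootProd u l) with hZdef
  -- `Z ⊆ U(y)`
  have hZU : Z ⊆ posRootGroup G P u y := by
    rintro _ ⟨x, rfl⟩
    exact rootProd_mem u (fun i hi z => apply_mem_posRootGroup u ((hl' i).mp hi) z) x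
  -- dimensions
  have hU : IsZConnected (posRootGroup G P u y) := isZConnected_posRootGroup (P := P) hG hu y
  have hUle : hU.zdim ≤ l.length := by
    have h1 := zdim_posRootGroup_le hG hT h u hu y hdim
    have h2 : (Finset.univ.filter fun i => 0 < P.root' i y) = l.toFinset := by
      ext i; simp [hl' i]
    rw [h2, List.toFinset_card_of_nodup hl] at h1
    convert h1
  obtain ⟨hprime, hdimZ⟩ := ringKrullDim_quotient_idealSetGL_range_rootProd hPu l hl hq'
  -- `Z = U(y)`
  by_contra hne
  have hne' : Z ≠ (posRootGroup G P u y : Set (GL n k)) := fun hEq => hne (hEq ▸ le_rfl)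
  have hlt := ringKrullDim_quotient_lt_zdim_of_isPrime hU (range_rootProd_eq_zeroLocusGL hPu l hq')
    hprime hZU hne'
  rw [hdimZ] at hlt
  have : (l.length : ℕ∞) < (hU.zdim : ℕ∞) := by exact_mod_cast hlt
  have : l.length < hU.zdim := by exact_mod_cast this
  omega

/-- **Springer 8.2.1 (surjectivity half, the named fact `posRootGroup_eq_prod`) from the
uniqueness of root subgroups 8.1.1 (i), in characteristic `0`** — for `G` connected reductive
and `T` a maximal torus, `dim 𝔤_α ≤ 1` for every root
(`finrank_lieWeightSpace_le_one_of_rootSubgroup_unique`), so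
`posRootGroup_subset_range_rootProd` applies. This bypasses the commutator relations 8.2.3 used by
`posRootGroup_eq_prod_of` (`PosRootGroupProduct.lean`).
[cite: SpringerLAG1998, Prop 8.2.1 with 8.1.1 (i) and Cor. 8.1.2] -/
theorem posRootGroup_eq_prod_of_rootSubgroup_unique [CharZero k]
    (h811 : rootSubgroup_unique (G := G) (T := T)) :
    posRootGroup_eq_prod (k := k) (ι := ι) (X := X) (Y := Y) G T := by
  intro _ _ hG hT P eX eY h u hu y hy l hl hl' g hg
  classical
  haveI : Finite ι := h.finite_index hG hT
  letI : Fintype ι := Fintype.ofFinite ι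
  have hdim : ∀ i, Module.finrank k ↥(lieWeightSpace G T (charOfWeight eX (P.root i))) ≤ 1 := by
    intro i
    obtain ⟨α, hα, hαi⟩ := h.exists_root_eq i
    rw [← hαi]
    exact finrank_lieWeightSpace_le_one_of_rootSubgroup_unique h811 hG hT hα
  obtain ⟨x, hx⟩ := posRootGroup_subset_range_rootProd hG.1.1 hT.2.1 h u hu y l hl hl' hdim hg
  exact ⟨x, hx.symm⟩

end Surjectivity

end Literature.NumberTheory.Automorphic

/-! ### Assembly: `chevalley_isomorphism` from step 1, 8.1.1 (i) and `𝔤^T ⊆ L(T)` -/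

namespace Literature.NumberTheory.Automorphic

variable {k : Type*} [Field k]
variable {ι X Y : Type*} [AddCommGroup X] [AddCommGroup Y]
variable {N N' : ℕ} {G T : Subgroup (GL (Fin N) k)} {G' T' : Subgroup (GL (Fin N') k)}
  [IsMulCommutative ↥T] [IsMulCommutative ↥T']

/-- **`chevalley_isomorphism` from step 1 of Springer's proof of 9.6.2 (the abstract isomorphism),
the uniqueness of root subgroups 8.1.1 (i) and `𝔤^T ⊆ L(T)` (5.4.7 with 7.6.4 (ii)), for `(G, T)`
and `(G', T')`.** The commutator relations 8.2.3 required by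
`chevalley_isomorphism_of_structureFacts₃` (`RootSpaceDimension.lean`) are no longer needed: in
characteristic `0`, 8.1.1 (i) gives `dim 𝔤_α ≤ 1`, whence both the product structure of `U(y)`
(8.2.1, `posRootGroup_eq_prod_of_rootSubgroup_unique`, by dimensions) and, with `𝔤^T ⊆ L(T)`,
the dimension formula 8.1.3 (ii) and the open big cell 8.3.11 (`bigCell_nhds_one_of_zdim`).
Remaining leaves of `Literature.NumberTheory.Automorphic.chevalley_isomorphism`:
`chevalley_isomorphism_abstract` (Springer 9.6.2, step 1: 9.4.3, 9.5.4), `rootSubgroup_unique`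
(8.1.1 (i)) and `lieWeightSpace_one_le_lieAlgebraGL` (5.4.7 + 7.6.4 (ii)), each for both groups.
[cite: SpringerLAG1998, 9.6.2 (proof) with 8.1.1 (i), 8.1.2, 8.1.3 (ii), 8.2.1, 8.3.11, 5.4.7, 7.6.4 (ii)] -/
theorem chevalley_isomorphism_of_structureFacts₄
    (hA : chevalley_isomorphism_abstract (k := k) (ι := ι) (X := X) (Y := Y) (G := G) (T := T)
      (G' := G') (T' := T'))
    (h811 : rootSubgroup_unique (k := k) (G := G) (T := T))
    (h0 : lieWeightSpace_one_le_lieAlgebraGL G T)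
    (h811' : rootSubgroup_unique (k := k) (G := G') (T := T'))
    (h0' : lieWeightSpace_one_le_lieAlgebraGL G' T') :
    chevalley_isomorphism (k := k) (ι := ι) (X := X) (Y := Y) (G := G) (T := T) (G' := G')
      (T' := T') := by
  intro _ _ hG hT hG' hT' P eX eY eX' eY' h h'
  exact chevalley_isomorphism_of_eq_prod hA (posRootGroup_eq_prod_of_rootSubgroup_unique h811)
    (bigCell_nhds_one_of_zdim (zdim_eq_rank_add_card_roots_of_rootSubgroup_unique h811 h0))
    (posRootGroup_eq_prod_of_rootSubgroup_unique h811')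
    (bigCell_nhds_one_of_zdim (zdim_eq_rank_add_card_roots_of_rootSubgroup_unique h811' h0'))
    hG hT hG' hT' h h'

end Literature.NumberTheory.Automorphic
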